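import Summits.AtomisticToContinuum.Crystallization.Theses.PricedLinkCensus
import Summits.AtomisticToContinuum.Crystallization.Theorems.PricedLinkCensusLayeringGlue
import Summits.AtomisticToContinuum.Crystallization.Theorems.PricedLinkCensusStackingHingeSlpMatchTransfer
import Literature.MathematicalPhysics.StatisticalMechanics.LennardJonesClusters
import Literature.Probability.Process.PointStationaryLaw
import Mathlib

/-!
# `PricedLinkCensus.StackingHinge` (stmt-AtomisticToContinuum-14993), line `Sketch`,
# stub `stub_rootSlpGoodOfTransfer`: the root of the Benjamini–Schramm limit law is SLP-good a.s.

Transfer, part (b).  Let `P` be the Benjamini–Schramm limit (item 9230) of a Lennard-Jones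
ground-state sequence `x` along `φ`, with its hard-core clause and its DENSITY-TRANSFER clause
(finite-`N` densities of `(R, ε)`-windows are bounded BELOW by `P`-probabilities).  Granted the
deterministic metric lemma `stub_slpMatchTransfer` (part (a), the first hypothesis, verbatim),
`SoftLayerPropagation` and the inlined `ChargeFreeWindows`, the root `0` of `P`-a.e. configuration
`count|S` is SLP-good: for all real `t > nn/6`, `r < 3 nn` (`nn = infDist 0 (S ∖ {0})`) the
configuration in the `r`-ball about `0` is `t`-matched both ways to a rigid image of a Barlow
stacking `barlowStacking nn (nn √(2/3)) s`, `s` Hägg.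

Proof (contraposition on bad sets).  For rational `σ ∈ (0, 1]`, `τ > 0` let
`T σ τ = {count|S : 0 ∈ S, S not (σ, τ)-matched}` ((σ, τ)-matched = the conclusion of part (a)).
If `P (T σ τ) > 0`, the transfer clause with `R = 40/δ₁ + 1`, `ε = min σ τ · δ₁ / 20`
(`δ₁ = min δ_LJ 1`, `δ_LJ` the uniform minimal distance of `LennardJonesMinimalDistance_holds`, so that
`δ₁ ≤ nn_i ≤ 10/δ₁` at every site of every ground state with `N ≥ 2`) produces, eventually in `j`,
`ρ φ_j` sites of `x (φ j)` whose `(R, ε)`-window is close to some `count|S' ∈ T σ τ`; by part (a) and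
`SoftLayerPropagation` (at `η = 1/100`) none of them has a charge-free `8 nn_i`-window, contradicting
`ChargeFreeWindows` along `φ`.  Hence a.e. `count|S` is `(σ, τ)`-matched for all rational parameters,
and SLP-goodness at `(t, r)` follows from `(σ, τ)` with `τ < t − nn/6`, `σ ≤ min 1 ((3nn − r)/nn)`.

`stub_rootSlpGoodCore` is the same statement with the hypothesis (a) discharged by the landed
`PricedHcpWindowsSlpMatchTransfer.stub_slpMatchTransfer` (registered helper stub of this file: the registry
cannot hold the 5107-character statement of `stub_rootSlpGoodOfTransfer`, whose skeleton registration was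
truncated at 3900 characters).
-/

namespace Summit.AtomisticToContinuum.Crystallization.Theorems.PricedHcpWindowsRootSlpGood

open MeasureTheory Filter Topology
open Literature.MathematicalPhysics.StatisticalMechanics Literature.Geometry.DiscreteGeometry
open Literature.Probability.Process

/-- Arithmetic of the transfer constants: with `ε = min σ τ · δ₁ / 20`, `R = 40/δ₁ + 1` and
`δ₁ ≤ nn ≤ 10/δ₁`, `δ₁ ≤ 1`, the numeric side conditions of part (a) hold. [folklore] -/
theorem rsg_constants {σ τ δ₁ nn : ℝ} (hσ : 0 < σ) (hτ : 0 < τ) (hδ₁ : 0 < δ₁) (hδ₁1 : δ₁ ≤ 1)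
    (h1 : δ₁ ≤ nn) (h2 : nn ≤ 10 / δ₁) :
    0 < min σ τ * δ₁ / 20 ∧ 20 * (min σ τ * δ₁ / 20) ≤ σ * nn ∧
      20 * (min σ τ * δ₁ / 20) ≤ τ ∧ 4 * nn + 1 ≤ 40 / δ₁ + 1 := by
  refine ⟨div_pos (mul_pos (lt_min hσ hτ) hδ₁) (by norm_num), ?_, ?_, ?_⟩
  · calc 20 * (min σ τ * δ₁ / 20) = min σ τ * δ₁ := by ring
      _ ≤ σ * δ₁ := mul_le_mul_of_nonneg_right (min_le_left _ _) hδ₁.le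
      _ ≤ σ * nn := mul_le_mul_of_nonneg_left h1 hσ.le
  · calc 20 * (min σ τ * δ₁ / 20) = min σ τ * δ₁ := by ring
      _ ≤ τ * 1 := mul_le_mul (min_le_right _ _) hδ₁1 hδ₁.le hτ.le
      _ = τ := mul_one τ
  · have h4 : 4 * nn ≤ 40 / δ₁ :=
      calc 4 * nn ≤ 4 * (10 / δ₁) := by linarith
        _ = 40 / δ₁ := by ring
    linarith

/-- The density contradiction behind the contrapositive use of the transfer clause: if every
`ρ < P(T)` is eventually (along `φ`) a lower bound for `a_j / φ_j`, `a_j ≤ b_j` eventually and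
`b_j / φ_j → 0`, then `P(T) = 0`. [folklore] -/
theorem rsg_null_of_transfer {α : Type*} [MeasurableSpace α] (P : Measure α) [IsFiniteMeasure P]
    (T : Set α) {φ : ℕ → ℕ} (hφ : StrictMono φ) {a b : ℕ → ℝ}
    (h1 : ∀ ρ : ℝ, ρ < (P T).toReal → ∀ᶠ j in atTop, ρ * (φ j : ℝ) ≤ a j)
    (h3 : Tendsto (fun j => b j / (φ j : ℝ)) atTop (𝓝 0))
    (h2 : ∀ᶠ j in atTop, a j ≤ b j) : P T = 0 := by
  by_contra hne
  have hpos : 0 < (P T).toReal := ENNReal.toReal_pos hne (measure_ne_top P T)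
  obtain ⟨j, hj1, hj2, hj3, hj4⟩ := ((h1 ((P T).toReal / 2) (half_lt_self hpos)).and
    (h2.and ((((tendsto_order.1 h3).2 ((P T).toReal / 2) (half_pos hpos))).and
      (eventually_ge_atTop 1)))).exists
  have hφj : (1 : ℝ) ≤ φ j := by exact_mod_cast hj4.trans (hφ.id_le j)
  rw [div_lt_iff₀ (by linarith)] at hj3
  linarith

/-- Almost-sure avoidance of a countable family of null sets indexed by rational parameters
`σ ∈ (0, 1]`, `τ > 0`. [folklore] -/
theorem rsg_ae_notMem_of_null {α : Type*} [MeasurableSpace α] {P : Measure α}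
    {T : ℚ → ℚ → Set α} (h : ∀ σ τ : ℚ, 0 < σ → σ ≤ 1 → 0 < τ → P (T σ τ) = 0) :
    ∀ᵐ μ ∂P, ∀ σ τ : ℚ, 0 < σ → σ ≤ 1 → 0 < τ → μ ∉ T σ τ := by
  refine ae_all_iff.2 fun σ => ae_all_iff.2 fun τ => ?_
  by_cases hσ : 0 < σ
  · by_cases hσ1 : σ ≤ 1
    · by_cases hτ : 0 < τ
      · filter_upwards [measure_eq_zero_iff_ae_notMem.1 (h σ τ hσ hσ1 hτ)] with μ hμ
        exact fun _ _ _ => hμ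
      · exact Eventually.of_forall fun μ _ _ h' => (hτ h').elim
    · exact Eventually.of_forall fun μ _ h' => (hσ1 h').elim
  · exact Eventually.of_forall fun μ h' => (hσ h').elim

/-- The closeness clauses of the transfer, stated through `ν {p} ≠ 0` for `ν = count|S` and through
`Set.range (k ↦ y k - y i)`, are the two-way `ε`-closeness hypotheses of part (a). [folklore] -/
theorem rsg_close_of_count {N : ℕ} (y : Fin N → EuclideanSpace ℝ (Fin 3)) (i : Fin N)
    (S : Set (EuclideanSpace ℝ (Fin 3))) (R ε : ℝ)
    (h : (∀ p : EuclideanSpace ℝ (Fin 3),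
        (Measure.count : Measure (EuclideanSpace ℝ (Fin 3))).restrict S {p} ≠ 0 → ‖p‖ ≤ R →
          ∃ q ∈ Set.range (fun k : Fin N => y k - y i), dist q p ≤ ε) ∧
      (∀ q ∈ Set.range (fun k : Fin N => y k - y i), ‖q‖ ≤ R →
        ∃ p : EuclideanSpace ℝ (Fin 3),
          (Measure.count : Measure (EuclideanSpace ℝ (Fin 3))).restrict S {p} ≠ 0 ∧ dist q p ≤ ε)) :
    (∀ p ∈ S, ‖p‖ ≤ R → ∃ k : Fin N, dist (y k - y i) p ≤ ε) ∧
      (∀ k : Fin N, ‖y k - y i‖ ≤ R → ∃ p ∈ S, dist (y k - y i) p ≤ ε) := by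
  simp only [count_restrict_singleton_ne_zero_iff, Set.forall_mem_range,
    Set.exists_range_iff] at h
  exact h

/-- From `(σ, τ)`-matching of `S` about `0` for all rational `σ ∈ (0, 1]`, `τ > 0` (radius
`(3 - σ) nn`, tolerance `nn/6 + τ`) to SLP-goodness at every real `t > nn/6`, `r < 3 nn`
(generic in the pattern family `B` and the admissibility predicate `H`). [folklore] -/
theorem rsg_slpGood_of_matched {B : (ℤ → ℤ) → Set (EuclideanSpace ℝ (Fin 3))} {H : (ℤ → ℤ) → Prop}
    {S : Set (EuclideanSpace ℝ (Fin 3))} {nn : ℝ} (hnn : 0 ≤ nn)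
    (hM : ∀ σ τ : ℚ, 0 < σ → σ ≤ 1 → 0 < τ → ∃ s : ℤ → ℤ, H s ∧
      ∃ g : EuclideanSpace ℝ (Fin 3) ≃ᵃⁱ[ℝ] EuclideanSpace ℝ (Fin 3),
        (∀ p ∈ S, ‖p‖ ≤ (3 - (σ : ℝ)) * nn → ∃ z ∈ B s, dist p (g z) ≤ nn / 6 + (τ : ℝ)) ∧
        (∀ z ∈ B s, ‖g z‖ ≤ (3 - (σ : ℝ)) * nn → ∃ p ∈ S, dist p (g z) ≤ nn / 6 + (τ : ℝ))) :
    ∀ t r : ℝ, nn / 6 < t → r < 3 * nn → ∃ s : ℤ → ℤ, H s ∧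
      ∃ g : EuclideanSpace ℝ (Fin 3) ≃ᵃⁱ[ℝ] EuclideanSpace ℝ (Fin 3),
        (∀ y ∈ S, dist (0 : EuclideanSpace ℝ (Fin 3)) y ≤ r → ∃ z ∈ B s, dist y (g z) ≤ t) ∧
        (∀ z ∈ B s, dist (0 : EuclideanSpace ℝ (Fin 3)) (g z) ≤ r →
          ∃ y ∈ S, dist y (g z) ≤ t) := by
  intro t r ht hr
  obtain ⟨τ, hτ0, hτt⟩ := exists_rat_btwn (sub_pos.2 ht)
  obtain ⟨σ, hσ0, hσ1, hσr⟩ : ∃ σ : ℚ, 0 < σ ∧ σ ≤ 1 ∧ r ≤ (3 - (σ : ℝ)) * nn := by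
    rcases hnn.eq_or_lt with h0 | hpos
    · refine ⟨1, one_pos, le_rfl, ?_⟩
      push_cast
      linarith
    · obtain ⟨σ, h1, h2⟩ := exists_rat_btwn (lt_min one_pos (div_pos (sub_pos.2 hr) hpos))
      refine ⟨σ, by exact_mod_cast h1, by exact_mod_cast h2.le.trans (min_le_left _ _), ?_⟩
      have h3 : (σ : ℝ) ≤ (3 * nn - r) / nn := h2.le.trans (min_le_right _ _)
      rw [le_div_iff₀ hpos] at h3
      linarith
  obtain ⟨s, hs, g, hA, hB⟩ := hM σ τ hσ0 hσ1 (by exact_mod_cast hτ0)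
  refine ⟨s, hs, g, fun y hy hyr => ?_, fun z hz hzr => ?_⟩
  · rw [dist_zero_left] at hyr
    obtain ⟨z, hz, hd⟩ := hA y hy (hyr.trans hσr)
    exact ⟨z, hz, by linarith⟩
  · rw [dist_zero_left] at hzr
    obtain ⟨y, hy, hd⟩ := hB z hz (hzr.trans hσr)
    exact ⟨y, hy, by linarith⟩

/-- **stub_rootSlpGoodOfTransfer** (transfer, part (b): ROOT GOODNESS OF THE LIMIT LAW).  Granted part
(a) (`stub_slpMatchTransfer`, the first hypothesis verbatim), `SoftLayerPropagation` and the inlined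
`ChargeFreeWindows`, for the Benjamini–Schramm limit `P` of a ground-state sequence (hard-core clause
and density-transfer clause of item 9230), `P`-a.e. configuration is `count|S` with `0 ∈ S` and the
root `0` SLP-good.  By contraposition on the bad sets `T σ τ` (rational `σ ∈ (0,1]`, `τ > 0`): the
transfer clause would give a positive density of sites whose window is `ε`-close to a non-matched
`count|S'`, but such sites have no charge-free `8 nn_i`-window (part (a) + `SoftLayerPropagation`),
against `ChargeFreeWindows` along `φ`. [folklore] -/
theorem stub_rootSlpGoodOfTransfer : (∀ (N : ℕ) (y : Fin N → EuclideanSpace ℝ (Fin 3)) (i : Fin N) (S : Set (EuclideanSpace ℝ (Fin 3))) (σ τ R ε : ℝ), 0 < σ → σ ≤ 1 → 0 < τ → 0 < ε → 20 * ε ≤ σ * Literature.Geometry.DiscreteGeometry.nearestDist y i → 20 * ε ≤ τ → 4 * Literature.Geometry.DiscreteGeometry.nearestDist y i + 1 ≤ R → (∃ s : ℤ → ℤ, Literature.MathematicalPhysics.StatisticalMechanics.IsHaggSeq s ∧ ∃ g : EuclideanSpace ℝ (Fin 3) ≃ᵃⁱ[ℝ] EuclideanSpace ℝ (Fin 3),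 (∀ j : Fin N, dist (y i) (y j) ≤ 3 * Literature.Geometry.DiscreteGeometry.nearestDist y i → ∃ z ∈ Literature.MathematicalPhysics.StatisticalMechanics.barlowStacking (Literature.Geometry.DiscreteGeometry.nearestDist y i) (Literature.Geometry.DiscreteGeometry.nearestDist y i * Real.sqrt (2 / 3)) s, dist (y j) (g z) ≤ Literature.Geometry.DiscreteGeometry.nearestDist y i / 6) ∧ (∀ z ∈ Literature.MathematicalPhysics.StatisticalMechanics.barlowStacking (Literature.Geometry.DiscreteGeometry.nearestDist y i) (Literature.Geometry.DiscreteGeometry.nearestDist y i * Real.sqrt (2 / 3)) s, dist (y i) (g z) ≤ 3 * Literature.Geometry.DiscreteGeometry.nearestDist y i → ∃ j : Fin N, dist (y j) (g z) ≤ Literature.Geometry.DiscreteGeometry.nearestDist y i / 6)) → (0 : EuclideanSpace ℝ (Fin 3)) ∈ S → (∀ p ∈ S, ‖p‖ ≤ R → ∃ k : Fin N, dist (y k - y i) p ≤ ε) ∧ (∀ k : Fin N, ‖y k - y i‖ ≤ R → ∃ p ∈ S, dist (y k - y i) p ≤ ε) → (∃ s : ℤ → ℤ, Literature.MathematicalPhysics.StatisticalMechanics.IsHaggSeq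 s ∧ ∃ g : EuclideanSpace ℝ (Fin 3) ≃ᵃⁱ[ℝ] EuclideanSpace ℝ (Fin 3), (∀ p ∈ S, ‖p‖ ≤ (3 - σ) * Metric.infDist (0 : EuclideanSpace ℝ (Fin 3)) (S \ {0}) → ∃ z ∈ Literature.MathematicalPhysics.StatisticalMechanics.barlowStacking (Metric.infDist (0 : EuclideanSpace ℝ (Fin 3)) (S \ {0})) (Metric.infDist (0 : EuclideanSpace ℝ (Fin 3)) (S \ {0}) * Real.sqrt (2 / 3)) s, dist p (g z) ≤ Metric.infDist (0 : EuclideanSpace ℝ (Fin 3)) (S \ {0}) / 6 + τ) ∧ (∀ z ∈ Literature.MathematicalPhysics.StatisticalMechanics.barlowStacking (Metric.infDist (0 : EuclideanSpace ℝ (Fin 3)) (S \ {0})) (Metric.infDist (0 : EuclideanSpace ℝ (Fin 3)) (S \ {0}) * Real.sqrt (2 / 3)) s, ‖g z‖ ≤ (3 - σ) * Metric.infDist (0 : EuclideanSpace ℝ (Fin 3)) (S \ {0}) → ∃ p ∈ S, dist p (g z) ≤ Metric.infDist (0 : EuclideanSpace ℝ (Fin 3)) (S \ {0}) / 6 + τ)))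 → Summit.AtomisticToContinuum.Crystallization.Theses.PricedLinkCensus.SoftLayerPropagation → (∀ R : ℝ, 0 < R → ∀ x : (N : ℕ) → (Fin N → EuclideanSpace ℝ (Fin 3)), (∀ N, Literature.MathematicalPhysics.StatisticalMechanics.IsGroundState Literature.MathematicalPhysics.StatisticalMechanics.lennardJones (x N)) → Filter.Tendsto (fun N : ℕ => (Nat.card {i : Fin N // ¬ ∀ j : Fin N, dist (x N i) (x N j) ≤ R * Literature.Geometry.DiscreteGeometry.nearestDist (x N) i → Literature.Geometry.DiscreteGeometry.IsChargeFree (1 / 100 : ℝ) (x N) j} : ℝ) / N) Filter.atTop (nhds 0)) → ∀ x : (N : ℕ) → (Fin N → EuclideanSpace ℝ (Fin 3)), (∀ N, Literature.MathematicalPhysics.StatisticalMechanics.IsGroundState Literature.MathematicalPhysics.StatisticalMechanics.lennardJones (x N)) → ∀ φ : ℕ → ℕ, StrictMono φ → ∀ δ : ℝ, 0 < δ → ∀ P : MeasureTheory.Measure (MeasureTheory.Measure (EuclideanSpace ℝ (Fin 3))), MeasureTheory.IsProbabilityMeasure P → (∀ᵐ μ ∂P, (∃ S : Set (EuclideanSpace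 ℝ (Fin 3)), (0 : EuclideanSpace ℝ (Fin 3)) ∈ S ∧ (∀ x ∈ S, ∀ y ∈ S, x ≠ y → δ ≤ dist x y) ∧ μ = (MeasureTheory.Measure.count : MeasureTheory.Measure (EuclideanSpace ℝ (Fin 3))).restrict S)) → (∀ T : Set (MeasureTheory.Measure (EuclideanSpace ℝ (Fin 3))), ∀ R ε : ℝ, 0 < ε → ∀ ρ : ℝ, ρ < (P T).toReal → ∀ᶠ j : ℕ in Filter.atTop, ρ * (φ j : ℝ) ≤ (Nat.card {i : Fin (φ j) // ∃ ν ∈ T, ((∀ p : EuclideanSpace ℝ (Fin 3), ν {p} ≠ 0 → ‖p‖ ≤ R → ∃ q ∈ (Set.range (fun k : Fin (φ j) => x (φ j) k - x (φ j) i)), dist q p ≤ ε) ∧ (∀ q ∈ (Set.range (fun k : Fin (φ j) => x (φ j) k - x (φ j) i)), ‖q‖ ≤ R → ∃ p : EuclideanSpace ℝ (Fin 3), ν {p} ≠ 0 ∧ dist q p ≤ ε))} : ℝ)) → (∀ᵐ μ ∂P, ∃ S : Set (EuclideanSpace ℝ (Fin 3)), μ = (MeasureTheory.Measure.count : MeasureTheory.Measure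 (EuclideanSpace ℝ (Fin 3))).restrict S ∧ (0 : EuclideanSpace ℝ (Fin 3)) ∈ S ∧ (∀ t r : ℝ, Metric.infDist (0 : EuclideanSpace ℝ (Fin 3)) (S \ {(0 : EuclideanSpace ℝ (Fin 3))}) / 6 < t → r < 3 * Metric.infDist (0 : EuclideanSpace ℝ (Fin 3)) (S \ {(0 : EuclideanSpace ℝ (Fin 3))}) → ∃ s : ℤ → ℤ, Literature.MathematicalPhysics.StatisticalMechanics.IsHaggSeq s ∧ ∃ g : EuclideanSpace ℝ (Fin 3) ≃ᵃⁱ[ℝ] EuclideanSpace ℝ (Fin 3), (∀ y ∈ S, dist (0 : EuclideanSpace ℝ (Fin 3)) y ≤ r → ∃ z ∈ Literature.MathematicalPhysics.StatisticalMechanics.barlowStacking (Metric.infDist (0 : EuclideanSpace ℝ (Fin 3)) (S \ {(0 : EuclideanSpace ℝ (Fin 3))})) (Metric.infDist (0 : EuclideanSpace ℝ (Fin 3)) (S \ {(0 : EuclideanSpace ℝ (Fin 3))}) * Real.sqrt (2 / 3)) s, dist y (g z) ≤ t) ∧ (∀ z ∈ Literature.MathematicalPhysics.StatisticalMechanics.barlowStacking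 (Metric.infDist (0 : EuclideanSpace ℝ (Fin 3)) (S \ {(0 : EuclideanSpace ℝ (Fin 3))})) (Metric.infDist (0 : EuclideanSpace ℝ (Fin 3)) (S \ {(0 : EuclideanSpace ℝ (Fin 3))}) * Real.sqrt (2 / 3)) s, dist (0 : EuclideanSpace ℝ (Fin 3)) (g z) ≤ r → ∃ y ∈ S, dist y (g z) ≤ t))) := by
  intro hMT hSLP hCFW x hx φ hφ δ _ P hP hcore htr
  haveI := hP
  -- (1) constants: `δ₁ = min δ_LJ 1`, `δ₁ ≤ nn_i ≤ 10 / δ₁`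
  obtain ⟨δ₁, hδ₁pos, hδ₁1, hsep⟩ : ∃ δ₁ : ℝ, 0 < δ₁ ∧ δ₁ ≤ 1 ∧
      ∀ (N : ℕ) (i j : Fin N), i ≠ j → δ₁ ≤ dist (x N i) (x N j) := by
    obtain ⟨δ', hδ', hsep'⟩ := LennardJonesMinimalDistance_holds
    exact ⟨min δ' 1, lt_min hδ' one_pos, min_le_right _ _,
      fun N i j hij => (min_le_left _ _).trans (hsep' N (x N) (hx N) i j hij)⟩
  have hnnle : ∀ (N : ℕ) (i : Fin N), nearestDist (x N) i ≤ 10 / δ₁ := fun N i =>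
    nearestDist_le_of_isGroundState (hx N) hδ₁pos hδ₁1 (fun k l hkl => hsep N k l hkl) i
  have hnnge : ∀ (N : ℕ) (i : Fin N), 2 ≤ N → δ₁ ≤ nearestDist (x N) i := fun N i hN => by
    haveI := Fin.nontrivial_iff_two_le.2 hN
    exact le_nearestDist (exists_ne i) fun k hk => hsep N i k (Ne.symm hk)
  -- (2) `ChargeFreeWindows` at radius `8` along `φ`
  have h3 : Tendsto (fun j => (Nat.card {i : Fin (φ j) // ¬ ∀ j' : Fin (φ j),
      dist (x (φ j) i) (x (φ j) j') ≤ 8 * nearestDist (x (φ j)) i →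
        IsChargeFree (1 / 100 : ℝ) (x (φ j)) j'} : ℝ) / (φ j : ℝ)) atTop (𝓝 0) :=
    (hCFW 8 (by norm_num) x hx).comp hφ.tendsto_atTop
  -- (3) the bad sets `T σ τ` are `P`-null
  have hnull : ∀ σ τ : ℚ, 0 < σ → σ ≤ 1 → 0 < τ →
      P {ν | ∃ S : Set (EuclideanSpace ℝ (Fin 3)),
        ν = (Measure.count : Measure (EuclideanSpace ℝ (Fin 3))).restrict S ∧
        (0 : EuclideanSpace ℝ (Fin 3)) ∈ S ∧
        ¬ (∃ s : ℤ → ℤ, IsHaggSeq s ∧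
          ∃ g : EuclideanSpace ℝ (Fin 3) ≃ᵃⁱ[ℝ] EuclideanSpace ℝ (Fin 3),
          (∀ p ∈ S, ‖p‖ ≤ (3 - (σ : ℝ)) *
              Metric.infDist (0 : EuclideanSpace ℝ (Fin 3)) (S \ {0}) →
            ∃ z ∈ barlowStacking (Metric.infDist (0 : EuclideanSpace ℝ (Fin 3)) (S \ {0}))
              (Metric.infDist (0 : EuclideanSpace ℝ (Fin 3)) (S \ {0}) * Real.sqrt (2 / 3)) s,
              dist p (g z) ≤ Metric.infDist (0 : EuclideanSpace ℝ (Fin 3)) (S \ {0}) / 6 + (τ : ℝ)) ∧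
          (∀ z ∈ barlowStacking (Metric.infDist (0 : EuclideanSpace ℝ (Fin 3)) (S \ {0}))
              (Metric.infDist (0 : EuclideanSpace ℝ (Fin 3)) (S \ {0}) * Real.sqrt (2 / 3)) s,
            ‖g z‖ ≤ (3 - (σ : ℝ)) * Metric.infDist (0 : EuclideanSpace ℝ (Fin 3)) (S \ {0}) →
              ∃ p ∈ S, dist p (g z) ≤
                Metric.infDist (0 : EuclideanSpace ℝ (Fin 3)) (S \ {0}) / 6 + (τ : ℝ)))} = 0 := by
    intro σ τ hσ hσ1 hτ
    have hσ' : (0 : ℝ) < σ := by exact_mod_cast hσ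
    have hσ1' : (σ : ℝ) ≤ 1 := by exact_mod_cast hσ1
    have hτ' : (0 : ℝ) < τ := by exact_mod_cast hτ
    have hε : 0 < min (σ : ℝ) τ * δ₁ / 20 := div_pos (mul_pos (lt_min hσ' hτ') hδ₁pos) (by norm_num)
    refine rsg_null_of_transfer P _ hφ
      (fun ρ hρ => htr _ (40 / δ₁ + 1) (min (σ : ℝ) τ * δ₁ / 20) hε ρ hρ) h3 ?_
    filter_upwards [eventually_ge_atTop 2] with j hj
    have hN : 2 ≤ φ j := hj.trans (hφ.id_le j)
    refine Nat.cast_le.2 (Nat.card_le_card_of_injective (fun a => ⟨a.1, fun hgood => ?_⟩)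
      fun a b hab => Subtype.ext (by simpa using congrArg Subtype.val hab))
    obtain ⟨ν, ⟨S', rfl, h0', hnm⟩, hC⟩ := a.2
    obtain ⟨s, g, hs, hA, hB⟩ := hSLP (1 / 100) (by norm_num) le_rfl (φ j) (x (φ j)) a.1 hgood
    obtain ⟨hε', h20a, h20b, hR⟩ :=
      rsg_constants hσ' hτ' hδ₁pos hδ₁1 (hnnge (φ j) a.1 hN) (hnnle (φ j) a.1)
    exact hnm (hMT (φ j) (x (φ j)) a.1 S' σ τ (40 / δ₁ + 1) (min (σ : ℝ) τ * δ₁ / 20) hσ' hσ1'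
      hτ' hε' h20a h20b hR ⟨s, hs, g, hA, hB⟩ h0'
      (rsg_close_of_count (x (φ j)) a.1 S' (40 / δ₁ + 1) (min (σ : ℝ) τ * δ₁ / 20) hC))
  -- (4) conclusion: a.e. `count|S` avoids every `T σ τ`, hence its root is SLP-good
  filter_upwards [hcore, rsg_ae_notMem_of_null hnull] with μ hμ hgood
  obtain ⟨S, h0, _, rfl⟩ := hμ
  refine ⟨S, rfl, h0, rsg_slpGood_of_matched (H := IsHaggSeq)
    (B := barlowStacking (Metric.infDist (0 : EuclideanSpace ℝ (Fin 3)) (S \ {0}))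
      (Metric.infDist (0 : EuclideanSpace ℝ (Fin 3)) (S \ {0}) * Real.sqrt (2 / 3)))
    Metric.infDist_nonneg fun σ τ hσ hσ1 hτ => ?_⟩
  by_contra hM
  exact hgood σ τ hσ hσ1 hτ ⟨S, rfl, h0, hM⟩

/-- **stub_rootSlpGoodCore** (registered helper form of `stub_rootSlpGoodOfTransfer`): the same root-goodness
statement with the deterministic metric hypothesis (a) discharged by the landed theorem
`PricedHcpWindowsSlpMatchTransfer.stub_slpMatchTransfer`; `SoftLayerPropagation` and the inlined
`ChargeFreeWindows` make the root of the Benjamini–Schramm limit law SLP-good almost surely. [folklore] -/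
theorem stub_rootSlpGoodCore : Summit.AtomisticToContinuum.Crystallization.Theses.PricedLinkCensus.SoftLayerPropagation → (∀ R : ℝ, 0 < R → ∀ x : (N : ℕ) → (Fin N → EuclideanSpace ℝ (Fin 3)), (∀ N, Literature.MathematicalPhysics.StatisticalMechanics.IsGroundState Literature.MathematicalPhysics.StatisticalMechanics.lennardJones (x N)) → Filter.Tendsto (fun N : ℕ => (Nat.card {i : Fin N // ¬ ∀ j : Fin N, dist (x N i) (x N j) ≤ R * Literature.Geometry.DiscreteGeometry.nearestDist (x N) i → Literature.Geometry.DiscreteGeometry.IsChargeFree (1 / 100 : ℝ) (x N) j} : ℝ) / N) Filter.atTop (nhds 0)) → ∀ x : (N : ℕ) → (Fin N → EuclideanSpace ℝ (Fin 3)), (∀ N, Literature.MathematicalPhysics.StatisticalMechanics.IsGroundState Literature.MathematicalPhysics.StatisticalMechanics.lennardJones (x N)) → ∀ φ : ℕ → ℕ, StrictMono φ → ∀ δ : ℝ, 0 < δ → ∀ P : MeasureTheory.Measure (MeasureTheory.Measure (EuclideanSpace ℝ (Fin 3))), MeasureTheory.IsProbabilityMeasure P → (∀ᵐ μ ∂P,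 (∃ S : Set (EuclideanSpace ℝ (Fin 3)), (0 : EuclideanSpace ℝ (Fin 3)) ∈ S ∧ (∀ x ∈ S, ∀ y ∈ S, x ≠ y → δ ≤ dist x y) ∧ μ = (MeasureTheory.Measure.count : MeasureTheory.Measure (EuclideanSpace ℝ (Fin 3))).restrict S)) → (∀ T : Set (MeasureTheory.Measure (EuclideanSpace ℝ (Fin 3))), ∀ R ε : ℝ, 0 < ε → ∀ ρ : ℝ, ρ < (P T).toReal → ∀ᶠ j : ℕ in Filter.atTop, ρ * (φ j : ℝ) ≤ (Nat.card {i : Fin (φ j) // ∃ ν ∈ T, ((∀ p : EuclideanSpace ℝ (Fin 3), ν {p} ≠ 0 → ‖p‖ ≤ R → ∃ q ∈ (Set.range (fun k : Fin (φ j) => x (φ j) k - x (φ j) i)), dist q p ≤ ε) ∧ (∀ q ∈ (Set.range (fun k : Fin (φ j) => x (φ j) k - x (φ j) i)), ‖q‖ ≤ R → ∃ p : EuclideanSpace ℝ (Fin 3), ν {p} ≠ 0 ∧ dist q p ≤ ε))} : ℝ)) → (∀ᵐ μ ∂P, ∃ S : Set (EuclideanSpace ℝ (Fin 3)), μ = (MeasureTheory.Measure.count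 : MeasureTheory.Measure (EuclideanSpace ℝ (Fin 3))).restrict S ∧ (0 : EuclideanSpace ℝ (Fin 3)) ∈ S ∧ (∀ t r : ℝ, Metric.infDist (0 : EuclideanSpace ℝ (Fin 3)) (S \ {(0 : EuclideanSpace ℝ (Fin 3))}) / 6 < t → r < 3 * Metric.infDist (0 : EuclideanSpace ℝ (Fin 3)) (S \ {(0 : EuclideanSpace ℝ (Fin 3))}) → ∃ s : ℤ → ℤ, Literature.MathematicalPhysics.StatisticalMechanics.IsHaggSeq s ∧ ∃ g : EuclideanSpace ℝ (Fin 3) ≃ᵃⁱ[ℝ] EuclideanSpace ℝ (Fin 3), (∀ y ∈ S, dist (0 : EuclideanSpace ℝ (Fin 3)) y ≤ r → ∃ z ∈ Literature.MathematicalPhysics.StatisticalMechanics.barlowStacking (Metric.infDist (0 : EuclideanSpace ℝ (Fin 3)) (S \ {(0 : EuclideanSpace ℝ (Fin 3))})) (Metric.infDist (0 : EuclideanSpace ℝ (Fin 3)) (S \ {(0 : EuclideanSpace ℝ (Fin 3))}) * Real.sqrt (2 / 3)) s, dist y (g z) ≤ t) ∧ (∀ z ∈ Literature.MathematicalPhysics.StatisticalMechanics.barlowStacking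 (Metric.infDist (0 : EuclideanSpace ℝ (Fin 3)) (S \ {(0 : EuclideanSpace ℝ (Fin 3))})) (Metric.infDist (0 : EuclideanSpace ℝ (Fin 3)) (S \ {(0 : EuclideanSpace ℝ (Fin 3))}) * Real.sqrt (2 / 3)) s, dist (0 : EuclideanSpace ℝ (Fin 3)) (g z) ≤ r → ∃ y ∈ S, dist y (g z) ≤ t))) :=
  stub_rootSlpGoodOfTransfer PricedHcpWindowsSlpMatchTransfer.stub_slpMatchTransfer

end Summit.AtomisticToContinuum.Crystallization.Theorems.PricedHcpWindowsRootSlpGood
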